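import Literature.Geometry.GeometricMeasureTheory.CurrentsProduct
import Literature.Geometry.GeometricMeasureTheory.CurrentsPushforward
import Mathlib.MeasureTheory.Integral.IntervalIntegral.FundThmCalculus
import Mathlib.Analysis.Calculus.FDeriv.Symmetric
import Mathlib.Analysis.Calculus.FDeriv.CompCLM
import Mathlib.Analysis.Calculus.MeanValue

/-!
# The boundary of `[a, b] × T`, `δ_t × T`, and the homotopy formula

Sequel to `CurrentsProduct.lean` (Federer 4.1.8–4.1.9). For a current `T` on an open `Ω ⊆ E` and
the product `[a, b] × T` on the cylinder `ℝ × Ω`: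

* `iteratedFDeriv_snoc_eq_cons`, `iteratedFDeriv_fderiv_apply_comm` — symmetry of the iterated
  derivatives of a smooth map under rotation of the arguments (from the symmetry of second
  derivatives, `ContDiffAt.isSymmSndFDerivAt`), whence **`D^i(∂_e f) = ∂_e(D^i f)`**;
* `TestForm.tderiv`, `tderivD` — the time derivative `∂ₜφ = Dφ(e₀)` of a test form on the cylinder
  (Mathlib's `fderivCLM`); `exists_taylor_time` — the uniform first-order Taylor estimate
  `‖D^iφ(z + h e₀) − D^iφ(z) − h ∂_{e₀}D^iφ(z)‖ ≤ ε|h|` (mean value inequality);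
* **`Current.hasDerivAt_apply_sliceBy`** — `d/dt T(sliceBy L φ t) = T(sliceBy L (∂ₜφ) t)`
  (difference quotients converge in the seminorms of `𝓓_{snd K̃}`, on which `T` is bounded), and
  `integral_apply_sliceBy_tderiv : ∫_a^b T(sliceBy L ∂ₜφ t) dt = T(sliceBy L φ b) − T(sliceBy L φ a)`;
* `Current.timesDirac t T` — **`δ_t × T`**, `(δ_t × T)(φ) = T(j_t^* φ)`, `j_t(x) = (t, x)`;
* `TestForm.tslice_extDerivCLM` — `(dφ)^t = j_t^*(∂ₜφ) − d(φ^t)` for test forms, and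
  **`Current.boundary_prodInterval : ∂([a, b] × T) = δ_b × T − δ_a × T − [a, b] × ∂T`**
  [4.1.8: `∂(S × T) = ∂S × T + (−1)^{dim S} S × ∂T`];
* `Current.support_prodInterval_subset : spt([a,b] × T) ⊆ [a,b] × spt T`,
  `Current.support_timesDirac_subset : spt(δ_t × T) ⊆ {t} × spt T`;
* `Current.pushforward_timesDirac : H_#(δ_t × T) = (H ∘ j_t)_# T`, and **the homotopy formula**
  `Current.homotopy_formula : ∂ H_#([0,1] × T) = (H ∘ j₁)_# T − (H ∘ j₀)_# T − H_#([0,1] × ∂T)`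
  [4.1.9: "`g_# T − f_# T = ∂ h_#([0,1] × T) + h_#([0,1] × ∂T)`"], for a cutoff `= 1` near
  `spt([0,1] × T)`;
* `norm_covSlice_compContinuousLinearMap_le : ‖(ω ∘ ⋀DH)(e₀,·)|_E‖ ≤ ‖ω‖ ‖DH e₀‖ ‖DH|_E‖ᵐ` and
  **`Current.mass_pushforward_prodInterval_le`** — the mass estimate of 4.1.9 in sup form:
  `𝐌(H_#([0,1] × T)) ≤ M 𝐌(T)` whenever `|χ| ‖DH e₀‖ ‖DH|_E‖ᵐ ≤ M` on `spt χ` (for the affine homotopy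
  `DH e₀ = g − f`, `DH|_E = (1−t)Df + tDg`);
* `affineHomotopy f g`, its derivative (`fderiv_affineHomotopy_timeVec = g − f`,
  `fderiv_affineHomotopy_comp_inr = Df + t(Dg − Df)`), tensor cutoffs `ρ ⊗ χ` on the cylinder,
  **`Current.homotopy_formula_affine : g_# T − f_# T = ∂ h_#([0,1] × T) + h_#([0,1] × ∂T)`** and
  `Current.mass_affineHomotopy_le : 𝐌(h_#([0,1] × T)) ≤ M 𝐌(T)` for
  `|χ| ‖g − f‖ ‖Df + t(Dg − Df)‖ᵐ ≤ M` on `spt ρ × spt χ`;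
* `Current.pushforward_const` (`f_# T = 0` for constant `f`, positive degree), `Current.pushforward_id`,
  **the cone formula** `Current.cone_formula : T = ∂ h_#([0,1] × T) + h_#([0,1] × ∂T)` for the cone
  homotopy `h(t,x) = c + t(x − c)` (4.1.11; a cycle is the boundary of its cone) and
  `Current.mass_cone_le : 𝐌(h_#([0,1] × T)) ≤ r(1+δ)ᵐ 𝐌(T)` for `spt χ ⊆ 𝐁(c, r)`.

## References

* H. Federer, *Geometric Measure Theory*, Springer 1969, 4.1.8, 4.1.9, 4.1.11 [Federer1969].
-/

noncomputable section

open scoped Distributions ENNReal NNReal Topology ContDiff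
open MeasureTheory TopologicalSpace Set Filter Metric Function

namespace Literature.Geometry.GeometricMeasureTheory

set_option maxSynthPendingDepth 3

/-! ### Symmetry of higher derivatives under rotation -/

section Symmetry

variable {W F : Type*} [NormedAddCommGroup W] [NormedSpace ℝ W] [NormedAddCommGroup F]
  [NormedSpace ℝ F]

/-- `D^{n+2} f (x)(a, b, u) = (D² (D^n f)(x)(a)(b))(u)`: the first two slots of an iterated derivative
are a second derivative of a lower one. [folklore] -/
theorem iteratedFDeriv_cons_cons_eq {f : W → F} (hf : ContDiff ℝ ∞ f) (n : ℕ) (x a b : W)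
    (u : Fin n → W) :
    iteratedFDeriv ℝ (n + 2) f x (Fin.cons a (Fin.cons b u)) =
      (fderiv ℝ (fderiv ℝ (iteratedFDeriv ℝ n f)) x a b) u := by
  have hg : ContDiff ℝ ∞ (iteratedFDeriv ℝ n f) := hf.iteratedFDeriv_right (mod_cast le_top)
  have hdg : Differentiable ℝ (fderiv ℝ (iteratedFDeriv ℝ n f)) :=
    (contDiff_infty_iff_fderiv.1 hg).2.differentiable (by simp)
  have hd1 : Differentiable ℝ (iteratedFDeriv ℝ (n + 1) f) :=
    hf.differentiable_iteratedFDeriv (mod_cast ENat.coe_lt_top (n + 1))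
  rw [iteratedFDeriv_succ_apply_left, Fin.cons_zero, Fin.tail_cons,
    ← fderiv_continuousMultilinear_apply_const_apply (hd1 x) (Fin.cons b u) a]
  have hfun : (fun w => iteratedFDeriv ℝ (n + 1) f w (Fin.cons b u)) =
      fun w => (fderiv ℝ (iteratedFDeriv ℝ n f) w b) u := by
    funext w
    rw [iteratedFDeriv_succ_apply_left, Fin.cons_zero, Fin.tail_cons]
  rw [hfun, fderiv_continuousMultilinear_apply_const_apply ((hdg x).clm_apply
    (differentiableAt_const b)) u a, fderiv_clm_apply (hdg x) (differentiableAt_const b)]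
  simp

/-- **Swapping the first two slots of an iterated derivative of a smooth map.** [folklore] -/
theorem iteratedFDeriv_swap01 {f : W → F} (hf : ContDiff ℝ ∞ f) (n : ℕ) (x a b : W)
    (u : Fin n → W) :
    iteratedFDeriv ℝ (n + 2) f x (Fin.cons a (Fin.cons b u)) =
      iteratedFDeriv ℝ (n + 2) f x (Fin.cons b (Fin.cons a u)) := by
  have hg : ContDiff ℝ ∞ (iteratedFDeriv ℝ n f) := hf.iteratedFDeriv_right (mod_cast le_top)
  have hsymm := (hg.contDiffAt (x := x)).isSymmSndFDerivAt
    (by rw [minSmoothness_of_isRCLikeNormedField]; exact WithTop.coe_le_coe.2 le_top)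
  rw [iteratedFDeriv_cons_cons_eq hf n x a b u, iteratedFDeriv_cons_cons_eq hf n x b a u, hsymm.eq]

/-- Congruence in the tail slots: if `D^{n+1} f (w)(u) = D^{n+1} f (w)(u')` for all `w` then
`D^{n+2} f (x)(a, u) = D^{n+2} f (x)(a, u')`. [folklore] -/
theorem iteratedFDeriv_cons_congr {f : W → F} (hf : ContDiff ℝ ∞ f) (n : ℕ) (x a : W)
    {u u' : Fin (n + 1) → W}
    (h : ∀ w, iteratedFDeriv ℝ (n + 1) f w u = iteratedFDeriv ℝ (n + 1) f w u') :
    iteratedFDeriv ℝ (n + 2) f x (Fin.cons a u) = iteratedFDeriv ℝ (n + 2) f x (Fin.cons a u') := by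
  have hd1 : Differentiable ℝ (iteratedFDeriv ℝ (n + 1) f) :=
    hf.differentiable_iteratedFDeriv (mod_cast ENat.coe_lt_top (n + 1))
  rw [iteratedFDeriv_succ_apply_left, iteratedFDeriv_succ_apply_left]
  simp only [Fin.cons_zero, Fin.tail_cons]
  rw [← fderiv_continuousMultilinear_apply_const_apply (hd1 x) u a,
    ← fderiv_continuousMultilinear_apply_const_apply (hd1 x) u' a]
  congr 2
  funext w
  exact h w

/-- **Rotational symmetry of iterated derivatives of smooth maps**:
`D^{i+1} f (x)(v, e) = D^{i+1} f (x)(e, v)` (from the symmetry of second derivatives by induction).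
[folklore] -/
theorem iteratedFDeriv_snoc_eq_cons {f : W → F} (hf : ContDiff ℝ ∞ f) (e : W) :
    ∀ (i : ℕ) (x : W) (v : Fin i → W),
      iteratedFDeriv ℝ (i + 1) f x (Fin.snoc v e) = iteratedFDeriv ℝ (i + 1) f x (Fin.cons e v)
  | 0, x, v => by
      congr 1
      funext j
      rw [Fin.fin_one_eq_zero j]
      rfl
  | (i + 1), x, v => by
      have hv : (Fin.snoc v e : Fin (i + 2) → W) = Fin.cons (v 0) (Fin.snoc (Fin.tail v) e) := by
        conv_lhs => rw [← Fin.cons_self_tail v]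
        rw [Fin.cons_snoc_eq_snoc_cons]
      rw [hv, iteratedFDeriv_cons_congr hf i x (v 0)
        (fun w => iteratedFDeriv_snoc_eq_cons hf e i w (Fin.tail v)),
        iteratedFDeriv_swap01 hf i x (v 0) e (Fin.tail v), Fin.cons_self_tail]

/-- **Iterated differentiation commutes with a directional derivative** for smooth maps:
`D^i(w ↦ Df(w) e)(z) = (D(D^i f)(z)) e`. [folklore] -/
theorem iteratedFDeriv_fderiv_apply_comm {f : W → F} (hf : ContDiff ℝ ∞ f) (e : W) (i : ℕ)
    (z : W) : iteratedFDeriv ℝ i (fun w => fderiv ℝ f w e) z = fderiv ℝ (iteratedFDeriv ℝ i f) z e := by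
  have hdf : ContDiff ℝ ∞ (fderiv ℝ f) := (contDiff_infty_iff_fderiv.1 hf).2
  ext v
  have h1 : (fun w => fderiv ℝ f w e) = (ContinuousLinearMap.apply ℝ F e) ∘ fderiv ℝ f := rfl
  rw [h1, (ContinuousLinearMap.apply ℝ F e).iteratedFDeriv_comp_left hdf.contDiffAt
    (mod_cast le_top), ContinuousLinearMap.compContinuousMultilinearMap_coe, comp_apply,
    ContinuousLinearMap.apply_apply]
  have h2 : iteratedFDeriv ℝ i (fderiv ℝ f) z v e = iteratedFDeriv ℝ (i + 1) f z (Fin.snoc v e) := by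
    rw [iteratedFDeriv_succ_apply_right, Fin.init_snoc, Fin.snoc_last]
  rw [h2, iteratedFDeriv_snoc_eq_cons hf e i z v, iteratedFDeriv_succ_apply_left, Fin.cons_zero,
    Fin.tail_cons]

end Symmetry

/-! ### The time derivative `∂ₜφ` and the derivative of `t ↦ T(sliceBy L φ t)` -/

section TimeDerivative

variable {E : Type*} [NormedAddCommGroup E] [NormedSpace ℝ E] {Ω : Opens E} {m k : ℕ}

/-- The unit vector of the time axis in `ℝ × E`. [folklore] -/
def timeVec (E : Type*) [NormedAddCommGroup E] : ℝ × E := ((1 : ℝ), (0 : E))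

omit [NormedSpace ℝ E] in
/-- `‖e₀‖ = 1`. [folklore] -/
@[simp] theorem norm_timeVec : ‖timeVec E‖ = 1 := by
  simp [timeVec, Prod.norm_def]

/-- **The time derivative `∂ₜφ` of a test form on the cylinder**: `(∂ₜφ)(z) = Dφ(z)(e₀)`, again a test
form (Mathlib's `fderivCLM` followed by evaluation at `e₀`). [cite: Federer1969, 4.1.8] -/
def TestForm.tderiv : TestForm (cylinder Ω) (m + 1) →L[ℝ] TestForm (cylinder Ω) (m + 1) :=
  (TestFunction.postcompCLM (ContinuousLinearMap.apply ℝ (Covector (ℝ × E) (m + 1)) (timeVec E))).comp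
    (TestFunction.fderivCLM ℝ ⊤ ⊤)

/-- Formula: `(∂ₜφ)(z) = Dφ(z)(e₀)`. [folklore] -/
@[simp] theorem TestForm.tderiv_apply (φ : TestForm (cylinder Ω) (m + 1)) (z : ℝ × E) :
    TestForm.tderiv φ z = fderiv ℝ (⇑φ) z (timeVec E) := by
  simp [TestForm.tderiv, TestFunction.postcompCLM_apply, TestFunction.fderivCLM_apply]

/-- The time derivative on the steps `𝓓_K`. [folklore] -/
def tderivD {K : Compacts (ℝ × E)} :
    𝓓_{K}(ℝ × E, Covector (ℝ × E) (m + 1)) →L[ℝ] 𝓓_{K}(ℝ × E, Covector (ℝ × E) (m + 1)) :=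
  (ContDiffMapSupportedIn.postcompCLM
      (ContinuousLinearMap.apply ℝ (Covector (ℝ × E) (m + 1)) (timeVec E))).comp
    (ContDiffMapSupportedIn.fderivCLM ℝ ⊤ ⊤)

/-- Formula: `tderivD φ z = Dφ(z)(e₀)`. [folklore] -/
@[simp] theorem tderivD_apply {K : Compacts (ℝ × E)} (φ : 𝓓_{K}(ℝ × E, Covector (ℝ × E) (m + 1)))
    (z : ℝ × E) : tderivD φ z = fderiv ℝ (⇑φ) z (timeVec E) := by
  simp [tderivD, ContDiffMapSupportedIn.postcompCLM_apply, ContDiffMapSupportedIn.fderivCLM_apply]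

/-- `∂ₜ` commutes with the inclusions `𝓓_K → 𝓓`. [folklore] -/
theorem TestForm.tderiv_ofSupportedIn {K : Compacts (ℝ × E)} (hK : (K : Set (ℝ × E)) ⊆ cylinder Ω)
    (φ : 𝓓_{K}(ℝ × E, Covector (ℝ × E) (m + 1))) :
    TestForm.tderiv (TestFunction.ofSupportedIn hK φ : TestForm (cylinder Ω) (m + 1)) =
      TestFunction.ofSupportedIn hK (tderivD φ) := by
  apply TestFunction.ext; intro z
  rw [TestForm.tderiv_apply]
  change fderiv ℝ (⇑φ) z (timeVec E) = tderivD φ z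
  rw [tderivD_apply]

/-- `D^i(∂ₜφ) = ∂_{e₀}(D^iφ)` for `φ ∈ 𝓓_K̃`. [folklore] -/
theorem iteratedFDeriv_tderivD {K : Compacts (ℝ × E)} (φ : 𝓓_{K}(ℝ × E, Covector (ℝ × E) (m + 1)))
    (i : ℕ) (z : ℝ × E) :
    iteratedFDeriv ℝ i (⇑(tderivD φ)) z = fderiv ℝ (iteratedFDeriv ℝ i (⇑φ)) z (timeVec E) := by
  rw [show (⇑(tderivD φ) : ℝ × E → Covector (ℝ × E) (m + 1)) = fun w => fderiv ℝ (⇑φ) w (timeVec E)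
    from funext (tderivD_apply φ)]
  exact iteratedFDeriv_fderiv_apply_comm φ.contDiff _ i z

/-- **Uniform first-order Taylor estimate in the time direction** for the derivatives of
`φ ∈ 𝓓_K̃`: for `|h|` small, `‖D^iφ(z + h e₀) − D^iφ(z) − h ∂_{e₀}D^iφ(z)‖ ≤ ε |h|` uniformly in `z`
(mean value inequality and uniform continuity of `∂_{e₀} D^iφ = D^i ∂ₜφ`). [folklore] -/
theorem exists_taylor_time {K : Compacts (ℝ × E)} (φ : 𝓓_{K}(ℝ × E, Covector (ℝ × E) (m + 1)))
    (i : ℕ) {ε : ℝ} (hε : 0 < ε) :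
    ∃ δ > 0, ∀ h : ℝ, |h| < δ → ∀ z : ℝ × E,
      ‖iteratedFDeriv ℝ i (⇑φ) (z + h • timeVec E) - iteratedFDeriv ℝ i (⇑φ) z -
        h • fderiv ℝ (iteratedFDeriv ℝ i (⇑φ)) z (timeVec E)‖ ≤ ε * |h| := by
  -- the derivative field `F w = ∂_{e₀} D^iφ (w) = D^i(∂ₜφ)(w)` is uniformly continuous
  set F : ℝ × E → ContinuousMultilinearMap ℝ (fun _ : Fin i => ℝ × E) (Covector (ℝ × E) (m + 1)) :=
    fun w => fderiv ℝ (iteratedFDeriv ℝ i (⇑φ)) w (timeVec E) with hF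
  have hFeq : ∀ w, F w = iteratedFDeriv ℝ i (⇑(tderivD φ)) w := fun w => by
    rw [hF, iteratedFDeriv_tderivD]
  obtain ⟨δ, hδ, hu⟩ := Metric.uniformContinuous_iff.1
    (uniformContinuous_iteratedFDeriv_supportedIn (tderivD φ) i) ε hε
  refine ⟨δ, hδ, fun h hh z => ?_⟩
  -- `G τ = D^iφ(z + τ e₀)` has derivative `F (z + τ e₀)`
  have hd : Differentiable ℝ (iteratedFDeriv ℝ i (⇑φ)) :=
    φ.contDiff.differentiable_iteratedFDeriv (mod_cast ENat.coe_lt_top i)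
  have hG : ∀ τ : ℝ, HasDerivAt (fun τ : ℝ => iteratedFDeriv ℝ i (⇑φ) (z + τ • timeVec E))
      (F (z + τ • timeVec E)) τ := by
    intro τ
    have hin : HasDerivAt (fun τ : ℝ => z + τ • timeVec E) (timeVec E) τ := by
      simpa using ((hasDerivAt_id τ).smul_const (timeVec E)).const_add z
    exact (hd (z + τ • timeVec E)).hasFDerivAt.comp_hasDerivAt τ hin
  -- mean value inequality for `τ ↦ G τ − τ • F z` on `[0, h]`
  have hmvt := Convex.norm_image_sub_le_of_norm_hasDerivWithin_le
    (f := fun τ : ℝ => iteratedFDeriv ℝ i (⇑φ) (z + τ • timeVec E) - τ • F z)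
    (f' := fun τ => F (z + τ • timeVec E) - F z) (s := Set.uIcc 0 h) (C := ε)
    (fun τ _ => ((hG τ).sub ((hasDerivAt_id τ).smul_const (F z))).hasDerivWithinAt.congr_deriv
      (by simp)) (fun τ hτ => ?_) (convex_uIcc 0 h) (left_mem_uIcc) (right_mem_uIcc)
  · have h0 : iteratedFDeriv ℝ i (⇑φ) (z + (0 : ℝ) • timeVec E) - (0 : ℝ) • F z =
        iteratedFDeriv ℝ i (⇑φ) z := by
      rw [zero_smul, add_zero, zero_smul ℝ (F z), sub_zero]
    rw [h0, sub_zero, Real.norm_eq_abs] at hmvt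
    rw [sub_right_comm]
    exact hmvt
  · rw [← dist_eq_norm, hFeq, hFeq]
    refine le_of_lt (hu ?_)
    rw [dist_eq_norm, add_sub_cancel_left, norm_smul, norm_timeVec, mul_one, Real.norm_eq_abs]
    refine lt_of_le_of_lt ?_ hh
    rcases le_total 0 h with h0 | h0
    · rw [Set.uIcc_of_le h0] at hτ
      rw [abs_of_nonneg hτ.1, abs_of_nonneg h0]; exact hτ.2
    · rw [Set.uIcc_of_ge h0] at hτ
      rw [abs_of_nonpos hτ.2, abs_of_nonpos h0]; linarith [hτ.1]

/-- The element of `𝓓_{snd K̃}` measuring the remainder of the difference quotient of slices: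
`ψ_h = sliceByD L φ (t+h) − sliceByD L φ t − h • sliceByD L (∂ₜφ) t`; its seminorms are
`≤ ‖L‖ ε |h|` once `|h| < δ` (from `exists_taylor_time`). [folklore] -/
theorem seminorm_sliceByD_remainder_le (L : Covector (ℝ × E) (m + 1) →L[ℝ] Covector E k)
    {K : Compacts (ℝ × E)} (φ : 𝓓_{K}(ℝ × E, Covector (ℝ × E) (m + 1))) (t h : ℝ) (i : ℕ)
    {ε : ℝ} (hε : 0 ≤ ε)
    (hT : ∀ z : ℝ × E, ‖iteratedFDeriv ℝ i (⇑φ) (z + h • timeVec E) - iteratedFDeriv ℝ i (⇑φ) z -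
        h • fderiv ℝ (iteratedFDeriv ℝ i (⇑φ)) z (timeVec E)‖ ≤ ε * |h|) :
    ContDiffMapSupportedIn.seminorm ℝ E (Covector E k) ⊤ (cylSnd K) i
      (sliceByD L φ (t + h) - sliceByD L φ t - h • sliceByD L (tderivD φ) t) ≤ ‖L‖ * (ε * |h|) := by
  rw [ContDiffMapSupportedIn.seminorm_top_le_iff ℝ (by positivity)]
  intro x _
  have hs : ∀ (ψ : 𝓓_{K}(ℝ × E, Covector (ℝ × E) (m + 1))) (τ : ℝ),
      ContDiff ℝ ∞ (fun y => L (ψ (τ, y))) := fun ψ τ =>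
    L.contDiff.comp (ψ.contDiff.comp (contDiff_const.prodMk contDiff_id))
  change ‖iteratedFDeriv ℝ i (((fun y => L (φ (t + h, y))) - (fun y => L (φ (t, y)))) -
    h • (fun y => L (tderivD φ (t, y)))) x‖ ≤ _
  have h1 : ContDiffAt ℝ (i : ℕ∞) (fun y => L (φ (t + h, y))) x :=
    (hs φ (t + h)).contDiffAt.of_le (mod_cast le_top)
  have h2 : ContDiffAt ℝ (i : ℕ∞) (fun y => L (φ (t, y))) x :=
    (hs φ t).contDiffAt.of_le (mod_cast le_top)
  have h3 : ContDiffAt ℝ (i : ℕ∞) (fun y => L (tderivD φ (t, y))) x :=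
    (hs (tderivD φ) t).contDiffAt.of_le (mod_cast le_top)
  have h12 : ContDiffAt ℝ (i : ℕ∞) ((fun y => L (φ (t + h, y))) - fun y => L (φ (t, y))) x :=
    h1.sub h2
  have h3' : ContDiffAt ℝ (i : ℕ∞) (h • fun y => L (tderivD φ (t, y))) x := h3.const_smul h
  rw [iteratedFDeriv_sub_apply h12 h3', iteratedFDeriv_sub_apply h1 h2,
    iteratedFDeriv_const_smul_apply h3]
  rw [iteratedFDeriv_clm_comp_slice L (⇑φ) φ.contDiff (t + h) i x,
    iteratedFDeriv_clm_comp_slice L (⇑φ) φ.contDiff t i x,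
    iteratedFDeriv_clm_comp_slice L (⇑(tderivD φ)) (tderivD φ).contDiff t i x,
    iteratedFDeriv_tderivD, ← map_smul, ← map_sub, ← map_sub]
  refine (norm_sliceDerivCLM_apply_le L i _).trans (mul_le_mul_of_nonneg_left ?_ (norm_nonneg L))
  have hz : ((t + h : ℝ), x) = ((t : ℝ), x) + h • timeVec E := by
    simp [timeVec, Prod.smul_mk]
  rw [hz]
  exact hT _

/-- **The derivative of `t ↦ T(sliceBy L φ t)` is `T(sliceBy L (∂ₜφ) t)`** for `φ ∈ 𝓓_K̃`
(difference quotients converge in the seminorms of `𝓓_{snd K̃}`, on which `T` is bounded).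
[cite: Federer1969, 4.1.8] -/
theorem Current.hasDerivAt_apply_sliceBy (T : Current Ω k)
    (L : Covector (ℝ × E) (m + 1) →L[ℝ] Covector E k) {K : Compacts (ℝ × E)}
    (hK : (K : Set (ℝ × E)) ⊆ cylinder Ω) (φ : 𝓓_{K}(ℝ × E, Covector (ℝ × E) (m + 1))) (t : ℝ) :
    HasDerivAt (fun s => T (TestForm.sliceBy L (TestFunction.ofSupportedIn hK φ) s))
      (T (TestForm.sliceBy L (TestFunction.ofSupportedIn hK (tderivD φ)) t)) t := by
  obtain ⟨s, C, hC⟩ := T.exists_seminorm_bound (cylSnd_subset hK)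
  rw [hasDerivAt_iff_tendsto_slope_zero]
  refine Metric.tendsto_nhdsWithin_nhds.2 fun ε hε => ?_
  set ε' : ℝ := ε / (2 * ((C : ℝ) + 1) * (‖L‖ + 1)) with hε'
  have hε'pos : 0 < ε' := div_pos hε (by positivity)
  have htay : ∀ i : ℕ, ∃ δ > 0, ∀ h : ℝ, |h| < δ → ∀ z : ℝ × E,
      ‖iteratedFDeriv ℝ i (⇑φ) (z + h • timeVec E) - iteratedFDeriv ℝ i (⇑φ) z -
        h • fderiv ℝ (iteratedFDeriv ℝ i (⇑φ)) z (timeVec E)‖ ≤ ε' * |h| := fun i =>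
    exists_taylor_time φ i hε'pos
  choose δf hδf htayf using htay
  classical
  set δ : ℝ := if hs : s.Nonempty then s.inf' hs δf else 1 with hδdef
  have hδpos : 0 < δ := by
    rw [hδdef]; split_ifs with hs
    · exact (Finset.lt_inf'_iff hs).2 fun i _ => hδf i
    · exact one_pos
  refine ⟨δ, hδpos, fun h hh0 hhδ => ?_⟩
  rw [dist_zero_right, Real.norm_eq_abs] at hhδ
  have hδi : ∀ i ∈ s, |h| < δf i := fun i hi => by
    refine lt_of_lt_of_le hhδ ?_
    rw [hδdef, dif_pos ⟨i, hi⟩]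
    exact Finset.inf'_le _ hi
  -- the remainder element and its seminorms
  set ψ := sliceByD L φ (t + h) - sliceByD L φ t - h • sliceByD L (tderivD φ) t with hψ
  have hsup : (s.sup (ContDiffMapSupportedIn.seminorm ℝ E (Covector E k) ⊤ (cylSnd K))) ψ ≤
      ‖L‖ * (ε' * |h|) :=
    Seminorm.finset_sup_apply_le (by positivity) fun i hi =>
      seminorm_sliceByD_remainder_le L φ t h i hε'pos.le (htayf i h (hδi i hi))
  have hTψ : |T (TestFunction.ofSupportedIn (cylSnd_subset hK) ψ)| ≤ C * (‖L‖ * (ε' * |h|)) :=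
    (hC ψ).trans (mul_le_mul_of_nonneg_left hsup C.coe_nonneg)
  -- the slope minus the candidate derivative is `h⁻¹ T(ψ)`
  have hslope : h⁻¹ • (T (TestForm.sliceBy L (TestFunction.ofSupportedIn hK φ) (t + h)) -
      T (TestForm.sliceBy L (TestFunction.ofSupportedIn hK φ) t)) -
      T (TestForm.sliceBy L (TestFunction.ofSupportedIn hK (tderivD φ)) t) =
        h⁻¹ * T (TestFunction.ofSupportedIn (cylSnd_subset hK) ψ) := by
    simp only [TestForm.sliceBy_ofSupportedIn, hψ, smul_eq_mul]
    have hh : (h : ℝ) ≠ 0 := hh0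
    rw [show TestFunction.ofSupportedIn (cylSnd_subset hK) (sliceByD L φ (t + h) - sliceByD L φ t -
        h • sliceByD L (tderivD φ) t) = TestFunction.ofSupportedIn (cylSnd_subset hK)
          (sliceByD L φ (t + h)) - TestFunction.ofSupportedIn (cylSnd_subset hK) (sliceByD L φ t) -
          h • TestFunction.ofSupportedIn (cylSnd_subset hK) (sliceByD L (tderivD φ) t) from rfl,
      map_sub, map_sub, map_smul, smul_eq_mul]
    field_simp
  rw [dist_eq_norm, Real.norm_eq_abs, hslope, abs_mul, abs_inv]
  calc |h|⁻¹ * |T (TestFunction.ofSupportedIn (cylSnd_subset hK) ψ)|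
      ≤ |h|⁻¹ * (C * (‖L‖ * (ε' * |h|))) :=
        mul_le_mul_of_nonneg_left hTψ (inv_nonneg.2 (abs_nonneg _))
    _ = C * ‖L‖ * ε' := by
        have : |h| ≠ 0 := abs_ne_zero.2 hh0
        field_simp
    _ < ε := by
        rw [hε']
        have hC0 : (0 : ℝ) ≤ C := C.coe_nonneg
        have hL0 : 0 ≤ ‖L‖ := norm_nonneg L
        rw [show (C : ℝ) * ‖L‖ * (ε / (2 * ((C : ℝ) + 1) * (‖L‖ + 1))) =
          ε * (C * ‖L‖ / (2 * ((C : ℝ) + 1) * (‖L‖ + 1))) by ring]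
        have h1 : (C : ℝ) * ‖L‖ / (2 * ((C : ℝ) + 1) * (‖L‖ + 1)) < 1 := by
          rw [div_lt_one (by positivity)]
          nlinarith [mul_nonneg hC0 hL0]
        nlinarith [mul_nonneg hC0 hL0, div_nonneg (mul_nonneg hC0 hL0)
          (show (0:ℝ) ≤ 2 * ((C : ℝ) + 1) * (‖L‖ + 1) by positivity)]

/-- The same for an arbitrary test form on the cylinder. [cite: Federer1969, 4.1.8] -/
theorem Current.hasDerivAt_apply_sliceBy' (T : Current Ω k)
    (L : Covector (ℝ × E) (m + 1) →L[ℝ] Covector E k) (φ : TestForm (cylinder Ω) (m + 1)) (t : ℝ) :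
    HasDerivAt (fun s => T (TestForm.sliceBy L φ s)) (T (TestForm.sliceBy L (TestForm.tderiv φ) t)) t := by
  have h := T.hasDerivAt_apply_sliceBy L (K := ⟨tsupport ⇑φ, φ.hasCompactSupport⟩) φ.tsupport_subset
    (TestFunction.toSupportedIn φ) t
  rw [← TestForm.tderiv_ofSupportedIn] at h
  exact h

/-- **`∫_a^b T(sliceBy L (∂ₜφ) t) dt = T(sliceBy L φ b) − T(sliceBy L φ a)`** (fundamental theorem of
calculus for `t ↦ T(sliceBy L φ t)`). [cite: Federer1969, 4.1.8] -/
theorem Current.integral_apply_sliceBy_tderiv (T : Current Ω k)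
    (L : Covector (ℝ × E) (m + 1) →L[ℝ] Covector E k) (φ : TestForm (cylinder Ω) (m + 1)) (a b : ℝ) :
    ∫ t in a..b, T (TestForm.sliceBy L (TestForm.tderiv φ) t) =
      T (TestForm.sliceBy L φ b) - T (TestForm.sliceBy L φ a) :=
  intervalIntegral.integral_eq_sub_of_hasDerivAt (fun t _ => T.hasDerivAt_apply_sliceBy' L φ t)
    (T.intervalIntegrable_apply_sliceBy L (TestForm.tderiv φ) a b)

end TimeDerivative

/-! ### `δ_t × T` and the boundary of the product current -/

section Boundary

variable {E : Type*} [NormedAddCommGroup E] [NormedSpace ℝ E] {Ω : Opens E} {m : ℕ}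

variable (E m) in
/-- Pull-back of `(m+1)`-covectors on `ℝ × E` to the slice `E`: `ω ↦ ω ∘ ⋀ inr`. [folklore] -/
abbrev slicePullCLM : Covector (ℝ × E) (m + 1) →L[ℝ] Covector E (m + 1) :=
  ContinuousAlternatingMap.compContinuousLinearMapCLM (ContinuousLinearMap.inr ℝ ℝ E)

/-- The value `(δ_t × T)(φ) = T(j_t^* φ)`. [cite: Federer1969, 4.1.8] -/
def Current.timesDiracFun (t : ℝ) (T : Current Ω (m + 1)) (φ : TestForm (cylinder Ω) (m + 1)) : ℝ :=
  T (TestForm.sliceBy (slicePullCLM E m) φ t)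

/-- **`δ_t × T = (j_t)_# T ∈ 𝒟_{m+1}(ℝ × Ω)`**, `(δ_t × T)(φ) = T(j_t^* φ)` with `j_t(x) = (t, x)`
[Federer1969, 4.1.8: the product with the `0`-current `δ_t`]. Continuity on `𝒟_K̃` by the bound
`|T(j_t^* φ)| ≤ C ‖·∘⋀inr‖ (s.sup N_K̃)(φ)`. [cite: Federer1969, 4.1.8] -/
def Current.timesDirac (t : ℝ) (T : Current Ω (m + 1)) : Current (cylinder Ω) (m + 1) :=
  TestFunction.mkCLM ℝ (T.timesDiracFun t)
    (fun φ ψ => by unfold Current.timesDiracFun; rw [TestForm.sliceBy_add, map_add])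
    (fun c φ => by unfold Current.timesDiracFun; rw [TestForm.sliceBy_smul, map_smul])
    fun K hK => by
      obtain ⟨s, C, hC⟩ := T.exists_seminorm_bound (cylSnd_subset hK)
      let ℓ : 𝓓_{K}(ℝ × E, Covector (ℝ × E) (m + 1)) →ₗ[ℝ] ℝ :=
        { toFun := fun φ => T.timesDiracFun t (TestFunction.ofSupportedInCLM ℝ hK φ)
          map_add' := fun φ ψ => by
            rw [map_add]; unfold Current.timesDiracFun; rw [TestForm.sliceBy_add, map_add]
          map_smul' := fun c φ => by
            rw [map_smul]; unfold Current.timesDiracFun; rw [TestForm.sliceBy_smul, map_smul]; rfl }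
      have hcont : Continuous ℓ :=
        WithSeminorms.continuous_of_isBounded
          (ContDiffMapSupportedIn.withSeminorms ℝ (ℝ × E) (Covector (ℝ × E) (m + 1)) ⊤ K)
          (norm_withSeminorms ℝ ℝ) ℓ (.of_real fun _ => ⟨s, C * ‖slicePullCLM E m‖, fun φ => by
            show ‖T.timesDiracFun t (TestFunction.ofSupportedIn hK φ)‖ ≤ _
            rw [Real.norm_eq_abs]
            exact T.abs_apply_sliceBy_le (slicePullCLM E m) hK hC φ t⟩)
      exact hcont

/-- Unfolding: `(δ_t × T)(φ) = T(j_t^* φ)`. [cite: Federer1969, 4.1.8] -/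
theorem Current.timesDirac_apply (t : ℝ) (T : Current Ω (m + 1)) (φ : TestForm (cylinder Ω) (m + 1)) :
    T.timesDirac t φ = T (TestForm.sliceBy (slicePullCLM E m) φ t) := rfl

/-- **The Cartan-type identity for test forms**: `(dφ)^t = j_t^*(∂ₜφ) − d(φ^t)`.
[cite: Federer1969, 4.1.8] -/
theorem TestForm.tslice_extDerivCLM (φ : TestForm (cylinder Ω) (m + 1)) (t : ℝ) :
    TestForm.tslice (TestForm.extDerivCLM φ) t =
      TestForm.sliceBy (slicePullCLM E m) (TestForm.tderiv φ) t -
        TestForm.extDerivCLM (TestForm.tslice φ t) := by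
  apply TestFunction.ext
  intro x
  rw [TestForm.tslice_apply, show (TestForm.sliceBy (slicePullCLM E m) (TestForm.tderiv φ) t -
      TestForm.extDerivCLM (TestForm.tslice φ t)) x =
      TestForm.sliceBy (slicePullCLM E m) (TestForm.tderiv φ) t x -
        TestForm.extDerivCLM (TestForm.tslice φ t) x from rfl,
    TestForm.sliceBy_apply, TestForm.tderiv_apply]
  have h1 := congrFun (TestForm.extDerivCLM_apply φ) (t, x)
  have h2 := congrFun (TestForm.extDerivCLM_apply (TestForm.tslice φ t)) x
  rw [h1, h2]
  exact covSlice_extDeriv (φ.contDiff.of_le (WithTop.coe_le_coe.2 le_top))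

/-- **The boundary of the product current**:
`∂([a, b] × T) = δ_b × T − δ_a × T − [a, b] × ∂T` [Federer1969, 4.1.8:
"`∂(S × T) = (∂S) × T + (−1)^{dim S} S × ∂T`" with `S = [a, b]`, `∂[a, b] = δ_b − δ_a`].
Proof: `([a,b] × T)(dφ) = ∫_a^b T((dφ)^t) dt = ∫_a^b T(j_t^* ∂ₜφ) dt − ∫_a^b ∂T(φ^t) dt` by the
Cartan-type identity, and the first integral is `T(j_b^* φ) − T(j_a^* φ)` by the fundamental
theorem of calculus for `t ↦ T(j_t^* φ)`. [cite: Federer1969, 4.1.8] -/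
theorem Current.boundary_prodInterval (T : Current Ω (m + 1)) (a b : ℝ) :
    (T.prodInterval a b).boundary =
      T.timesDirac b - T.timesDirac a - T.boundary.prodInterval a b := by
  ext φ
  rw [Current.boundary_apply, Current.prodInterval_apply,
    show (T.timesDirac b - T.timesDirac a - T.boundary.prodInterval a b) φ =
      T.timesDirac b φ - T.timesDirac a φ - T.boundary.prodInterval a b φ from rfl,
    Current.timesDirac_apply, Current.timesDirac_apply, Current.prodInterval_apply]
  simp_rw [TestForm.tslice_extDerivCLM, map_sub]
  have hint : IntervalIntegrable (fun t => T (TestForm.extDerivCLM (TestForm.tslice φ t))) volume a b :=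
    T.boundary.intervalIntegrable_apply_sliceBy (covSliceCLM (E := E) (F := ℝ) (m := m)) φ a b
  rw [intervalIntegral.integral_sub (T.intervalIntegrable_apply_sliceBy _ _ a b) hint,
    T.integral_apply_sliceBy_tderiv (slicePullCLM E m) φ a b]
  rfl

end Boundary

/-! ### Supports of the product currents -/

section Supports

variable {E : Type*} [NormedAddCommGroup E] [NormedSpace ℝ E] {Ω : Opens E} {m k : ℕ}

/-- A slice of a form supported in `W ×ˢ U`-type sets: if `(t, x) ∉ tsupport φ` for all `x ∉ U`
then `spt(sliceBy L φ t) ⊆ closure U`; here the pointwise version. [folklore] -/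
theorem TestForm.sliceBy_apply_eq_zero (L : Covector (ℝ × E) (m + 1) →L[ℝ] Covector E k)
    (φ : TestForm (cylinder Ω) (m + 1)) {t : ℝ} {x : E} (h : ((t : ℝ), x) ∉ tsupport ⇑φ) :
    TestForm.sliceBy L φ t x = 0 := by
  rw [TestForm.sliceBy_apply, image_eq_zero_of_notMem_tsupport h, map_zero]

/-- **`spt ([a, b] × T) ⊆ [a, b] × spt T`.** [cite: Federer1969, 4.1.8] -/
theorem Current.support_prodInterval_subset (T : Current Ω m) (a b : ℝ) :
    (T.prodInterval a b).support ⊆ Set.uIcc a b ×ˢ T.support := by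
  intro p hp
  by_contra hnot
  obtain ⟨hpΩ, hpU⟩ := hp
  rw [Set.mem_prod, not_and_or] at hnot
  rcases hnot with ht | hx
  · -- `p.1 ∉ [a, b]`: forms supported in `[a,b]ᶜ × E` have vanishing slices on `[a, b]`
    obtain ⟨φ, hφ, hφ0⟩ := hpU ((Set.uIcc a b)ᶜ ×ˢ univ)
      ((isClosed_Icc.isOpen_compl.prod isOpen_univ).mem_nhds ⟨ht, mem_univ _⟩)
    refine hφ0 ?_
    rw [Current.prodInterval_apply]
    refine intervalIntegral.integral_zero_ae (Eventually.of_forall fun t ht' => ?_)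
    have htI : t ∈ Set.uIcc a b := Set.uIoc_subset_uIcc ht'
    have hslice : TestForm.tslice φ t = 0 := by
      apply TestFunction.ext; intro x
      exact TestForm.sliceBy_apply_eq_zero _ φ (fun h => (hφ h).1 htI)
    rw [hslice, map_zero]
  · -- `p.2 ∉ spt T`
    have hxΩ : p.2 ∈ (Ω : Set E) := by
      have := hpΩ; rw [coe_cylinder] at this; exact this.2
    obtain ⟨U, hU, hTU⟩ := T.exists_nhds_of_not_mem_support hxΩ hx
    obtain ⟨C, ⟨hC, hCcl⟩, hCU⟩ := (closed_nhds_basis p.2).mem_iff.1 hU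
    obtain ⟨φ, hφ, hφ0⟩ := hpU (univ ×ˢ interior C)
      ((isOpen_univ.prod isOpen_interior).mem_nhds ⟨mem_univ _, mem_interior_iff_mem_nhds.2 hC⟩)
    refine hφ0 ?_
    rw [Current.prodInterval_apply]
    refine intervalIntegral.integral_zero_ae (Eventually.of_forall fun t _ => ?_)
    apply hTU
    refine (closure_minimal (fun x hx' => ?_) hCcl).trans hCU
    have hmem : ((t : ℝ), x) ∈ tsupport ⇑φ := by
      by_contra hc; exact hx' (TestForm.sliceBy_apply_eq_zero _ φ hc)
    exact interior_subset (hφ hmem).2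

/-- **`spt (δ_t × T) ⊆ {t} × spt T`.** [cite: Federer1969, 4.1.8] -/
theorem Current.support_timesDirac_subset (T : Current Ω (m + 1)) (t : ℝ) :
    (T.timesDirac t).support ⊆ ({t} : Set ℝ) ×ˢ T.support := by
  intro p hp
  by_contra hnot
  obtain ⟨hpΩ, hpU⟩ := hp
  rw [Set.mem_prod, not_and_or] at hnot
  rcases hnot with ht | hx
  · obtain ⟨φ, hφ, hφ0⟩ := hpU (({t} : Set ℝ)ᶜ ×ˢ univ)
      ((isClosed_singleton.isOpen_compl.prod isOpen_univ).mem_nhds ⟨ht, mem_univ _⟩)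
    refine hφ0 ?_
    rw [Current.timesDirac_apply]
    have hslice : TestForm.sliceBy (slicePullCLM E m) φ t = 0 := by
      apply TestFunction.ext; intro x
      exact TestForm.sliceBy_apply_eq_zero _ φ (fun h => (hφ h).1 rfl)
    rw [hslice, map_zero]
  · have hxΩ : p.2 ∈ (Ω : Set E) := by
      have := hpΩ; rw [coe_cylinder] at this; exact this.2
    obtain ⟨U, hU, hTU⟩ := T.exists_nhds_of_not_mem_support hxΩ hx
    obtain ⟨C, ⟨hC, hCcl⟩, hCU⟩ := (closed_nhds_basis p.2).mem_iff.1 hU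
    obtain ⟨φ, hφ, hφ0⟩ := hpU (univ ×ˢ interior C)
      ((isOpen_univ.prod isOpen_interior).mem_nhds ⟨mem_univ _, mem_interior_iff_mem_nhds.2 hC⟩)
    refine hφ0 ?_
    rw [Current.timesDirac_apply]
    apply hTU
    refine (closure_minimal (fun x hx' => ?_) hCcl).trans hCU
    have hmem : ((t : ℝ), x) ∈ tsupport ⇑φ := by
      by_contra hc; exact hx' (TestForm.sliceBy_apply_eq_zero _ φ hc)
    exact interior_subset (hφ hmem).2

end Supports

/-! ### Push-forwards of the product currents and the homotopy formula -/

section Homotopy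

variable {E E' : Type*} [NormedAddCommGroup E] [NormedSpace ℝ E] [NormedAddCommGroup E']
  [NormedSpace ℝ E'] {Ω : Opens E} {Ω' : Opens E'} {m : ℕ}

/-- The slice `x ↦ χ(t, x)` of a scalar test function on the cylinder. [folklore] -/
def TestFunction.scalarSlice (χ : 𝓓(cylinder Ω, ℝ)) (t : ℝ) : 𝓓(Ω, ℝ) :=
  ⟨fun x => χ (t, x), χ.contDiff.comp (contDiff_const.prodMk contDiff_id),
    (χ.hasCompactSupport.isCompact.image continuous_snd).of_isClosed_subset (isClosed_tsupport _)
      (tsupport_comp_slice_subset (⇑χ) χ.hasCompactSupport t),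
    (tsupport_comp_slice_subset (⇑χ) χ.hasCompactSupport t).trans (by
      rintro _ ⟨p, hp, rfl⟩
      have := χ.tsupport_subset hp
      rw [coe_cylinder] at this
      exact this.2)⟩

/-- Formula for the scalar slice. [folklore] -/
@[simp] theorem TestFunction.scalarSlice_apply (χ : 𝓓(cylinder Ω, ℝ)) (t : ℝ) (x : E) :
    TestFunction.scalarSlice χ t x = χ (t, x) := rfl

/-- `j_t(x) = (t, x)` is smooth with `D j_t = inr`. [folklore] -/
theorem contDiff_sliceMap (t : ℝ) : ContDiff ℝ ∞ fun x : E => ((t : ℝ), x) :=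
  contDiff_const.prodMk contDiff_id

/-- `D(H ∘ j_t)(x) = DH(t,x) ∘ inr`. [folklore] -/
theorem fderiv_comp_sliceMap {H : ℝ × E → E'} (hH : ContDiff ℝ ∞ H) (t : ℝ) (x : E) :
    fderiv ℝ (fun y : E => H ((t : ℝ), y)) x =
      (fderiv ℝ H ((t : ℝ), x)).comp (ContinuousLinearMap.inr ℝ ℝ E) := by
  have hj : HasFDerivAt (fun y : E => ((t : ℝ), y)) (ContinuousLinearMap.inr ℝ ℝ E) x :=
    ((hasFDerivAt_const t x).prodMk (hasFDerivAt_id x)).congr_fderiv rfl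
  exact ((hH.differentiable (by simp) _).hasFDerivAt.comp x hj).fderiv

/-- **`H_#(δ_t × T) = (H ∘ j_t)_# T`** (with the sliced cutoff `χ(t, ·)`): pushing forward the
current `δ_t × T` along `H` is pushing `T` forward along the map `H(t, ·)`. [cite: Federer1969, 4.1.9] -/
theorem Current.pushforward_timesDirac (T : Current Ω (m + 1)) (t : ℝ) (χ : 𝓓(cylinder Ω, ℝ))
    {H : ℝ × E → E'} (hH : ContDiff ℝ ∞ H) :
    (T.timesDirac t).pushforward Ω' χ hH =
      T.pushforward Ω' (TestFunction.scalarSlice χ t) (hH.comp (contDiff_sliceMap t)) := by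
  ext φ
  rw [Current.pushforward_apply, Current.timesDirac_apply, Current.pushforward_apply]
  congr 1
  apply TestFunction.ext
  intro x
  rw [TestForm.sliceBy_apply, TestForm.pullback_apply, TestForm.pullback_apply,
    TestFunction.scalarSlice_apply, Function.comp_apply,
    show (H ∘ fun x : E => ((t : ℝ), x)) = (fun y : E => H ((t : ℝ), y)) from rfl,
    fderiv_comp_sliceMap hH t x, map_smul, ContinuousAlternatingMap.compContinuousLinearMapCLM_apply]
  -- associativity of precomposition (cf. `compContinuousLinearMap_compContinuousLinearMap` in
  -- `Literature.Analysis.Complex.PQPullback`, not imported here)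
  have hassoc : ((φ (H (t, x))).compContinuousLinearMap (fderiv ℝ H (t, x))).compContinuousLinearMap
      (ContinuousLinearMap.inr ℝ ℝ E) =
      (φ (H (t, x))).compContinuousLinearMap ((fderiv ℝ H (t, x)).comp (ContinuousLinearMap.inr ℝ ℝ E)) := by
    ext v; rfl
  rw [hassoc]

end Homotopy

section HomotopyFD

variable {E E' : Type*} [NormedAddCommGroup E] [NormedSpace ℝ E] [FiniteDimensional ℝ E]
  [NormedAddCommGroup E'] [NormedSpace ℝ E'] {Ω : Opens E} {Ω' : Opens E'} {m : ℕ}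

/-- **The homotopy formula** [Federer1969, 4.1.9: "`g_# T − f_# T = ∂ h_#([0,1] × T) + h_#([0,1] × ∂T)`"
for the affine homotopy `h` from `f` to `g`], in the form: for a smooth `H : ℝ × E → E'`, a current
`T ∈ 𝒟_{m+1}(Ω)` and a cutoff `χ` on the cylinder equal to `1` on a neighbourhood of
`[0, 1] × spt T`,
`∂ H_#([0,1] × T) = (H ∘ j₁)_# T − (H ∘ j₀)_# T − H_#([0,1] × ∂T)`.
Consequence of `∂ H_# = H_# ∂` (`Current.boundary_pushforward`), the boundary formula for the
product (`Current.boundary_prodInterval`) and `H_#(δ_t × T) = (H ∘ j_t)_# T`.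
[cite: Federer1969, 4.1.9] -/
theorem Current.homotopy_formula (T : Current Ω (m + 1)) (χ : 𝓓(cylinder Ω, ℝ)) {H : ℝ × E → E'}
    (hH : ContDiff ℝ ∞ H) {U : Set (ℝ × E)} (hU : IsOpen U)
    (hTU : (T.prodInterval 0 1).support ⊆ U) (hχ : ∀ p ∈ U, χ p = 1) :
    ((T.prodInterval 0 1).pushforward Ω' χ hH).boundary =
      T.pushforward Ω' (TestFunction.scalarSlice χ 1) (hH.comp (contDiff_sliceMap 1)) -
        T.pushforward Ω' (TestFunction.scalarSlice χ 0) (hH.comp (contDiff_sliceMap 0)) -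
          (T.boundary.prodInterval 0 1).pushforward Ω' χ hH := by
  rw [(T.prodInterval 0 1).boundary_pushforward χ hH hU hTU hχ, T.boundary_prodInterval 0 1,
    Current.pushforward_sub, Current.pushforward_sub, T.pushforward_timesDirac 1 χ hH,
    T.pushforward_timesDirac 0 χ hH]

end HomotopyFD

/-! ### The mass of `H_#([0,1] × T)` -/

section HomotopyMass

variable {E E' : Type*} [NormedAddCommGroup E] [NormedSpace ℝ E] [NormedAddCommGroup E']
  [NormedSpace ℝ E'] {Ω : Opens E} {Ω' : Opens E'} {m : ℕ}

/-- `covSlice` is linear: scalars. [folklore] -/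
theorem covSlice_smul {F : Type*} [NormedAddCommGroup F] [NormedSpace ℝ F] (c : ℝ)
    (η : (ℝ × E) [⋀^Fin (m + 1)]→L[ℝ] F) : (covSlice (c • η) : E [⋀^Fin m]→L[ℝ] F) = c • covSlice η :=
  map_smul (covSliceCLM (E := E) (F := F) (m := m)) c η

/-- **The key pointwise estimate of 4.1.9**: contracting the pulled-back covector with the time
direction costs one factor `‖DH(e₀)‖ = ‖∂ₜH‖` and `m` factors `‖DH|_E‖`:
`‖(ω ∘ ⋀DH)(e₀, ·)|_E‖ ≤ ‖ω‖ ‖DH e₀‖ ‖DH ∘ inr‖ᵐ`. [cite: Federer1969, 4.1.9] -/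
theorem norm_covSlice_compContinuousLinearMap_le (η : Covector E' (m + 1)) (A : ℝ × E →L[ℝ] E') :
    ‖(covSlice (η.compContinuousLinearMap A) : Covector E m)‖ ≤
      ‖η‖ * ‖A (timeVec E)‖ * ‖A.comp (ContinuousLinearMap.inr ℝ ℝ E)‖ ^ m := by
  refine ContinuousAlternatingMap.opNorm_le_bound _ (by positivity) fun v => ?_
  rw [covSlice_apply, ContinuousAlternatingMap.compContinuousLinearMap_apply]
  refine (η.le_opNorm _).trans ?_
  rw [Fin.prod_univ_succ]
  simp only [comp_apply, Fin.cons_zero, Fin.cons_succ]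
  rw [mul_assoc, mul_assoc]
  refine mul_le_mul_of_nonneg_left ?_ (norm_nonneg η)
  have h1 : ‖A ((1 : ℝ), (0 : E))‖ = ‖A (timeVec E)‖ := rfl
  rw [h1]
  refine mul_le_mul_of_nonneg_left ?_ (norm_nonneg (A (timeVec E)))
  calc ∏ i : Fin m, ‖A ((0 : ℝ), v i)‖ ≤ ∏ i : Fin m, ‖A.comp (ContinuousLinearMap.inr ℝ ℝ E)‖ * ‖v i‖ := by
        refine Finset.prod_le_prod (fun i _ => norm_nonneg _) fun i _ => ?_
        have : A ((0 : ℝ), v i) = (A.comp (ContinuousLinearMap.inr ℝ ℝ E)) (v i) := rfl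
        rw [this]
        exact ContinuousLinearMap.le_opNorm _ _
    _ = ‖A.comp (ContinuousLinearMap.inr ℝ ℝ E)‖ ^ m * ∏ i : Fin m, ‖v i‖ := by
        rw [Finset.prod_mul_distrib, Finset.prod_const, Finset.card_univ, Fintype.card_fin]

/-- **Mass of the homotopy current** [Federer1969, 4.1.9:
"`𝐌[h_#([0,1] × T)] ≤ sup {|f − g|} · sup{‖Df‖, ‖Dg‖}ᵐ 𝐌(T)`"-type estimate]: if
`|χ| ‖DH(e₀)‖ ‖DH|_E‖ᵐ ≤ M` on `spt χ`, then `𝐌(H_#([0,1] × T)) ≤ M · 𝐌(T)` (for the affine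
homotopy `DH(e₀) = g − f` and `DH|_E = (1−t) Df + t Dg`). [cite: Federer1969, 4.1.9] -/
theorem Current.mass_pushforward_prodInterval_le (T : Current Ω m) (χ : 𝓓(cylinder Ω, ℝ))
    {H : ℝ × E → E'} (hH : ContDiff ℝ ∞ H) {M : ℝ} (hM0 : 0 ≤ M)
    (hM : ∀ p ∈ tsupport ⇑χ, |χ p| * ‖fderiv ℝ H p (timeVec E)‖ *
      ‖(fderiv ℝ H p).comp (ContinuousLinearMap.inr ℝ ℝ E)‖ ^ m ≤ M) :
    ((T.prodInterval 0 1).pushforward Ω' χ hH).mass ≤ ENNReal.ofReal M * T.mass := by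
  refine iSup₂_le fun φ hφ => ?_
  rw [Current.pushforward_apply, Current.prodInterval_apply]
  -- pointwise comass bound for the slices of `χ H^# φ`
  have hb : ∀ t x, ‖TestForm.tslice (TestForm.pullback χ hH φ) t x‖ ≤ M := by
    intro t x
    rw [TestForm.tslice_apply, TestForm.pullback_apply, covSlice_smul, norm_smul, Real.norm_eq_abs]
    by_cases hp : ((t : ℝ), x) ∈ tsupport ⇑χ
    · calc |χ (t, x)| * ‖(covSlice ((φ (H (t, x))).compContinuousLinearMap (fderiv ℝ H (t, x))) :
            Covector E m)‖
          ≤ |χ (t, x)| * (‖φ (H (t, x))‖ * ‖fderiv ℝ H (t, x) (timeVec E)‖ *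
              ‖(fderiv ℝ H (t, x)).comp (ContinuousLinearMap.inr ℝ ℝ E)‖ ^ m) :=
            mul_le_mul_of_nonneg_left (norm_covSlice_compContinuousLinearMap_le _ _) (abs_nonneg _)
        _ ≤ |χ (t, x)| * (1 * ‖fderiv ℝ H (t, x) (timeVec E)‖ *
              ‖(fderiv ℝ H (t, x)).comp (ContinuousLinearMap.inr ℝ ℝ E)‖ ^ m) := by
            refine mul_le_mul_of_nonneg_left (mul_le_mul_of_nonneg_right
              (mul_le_mul_of_nonneg_right (hφ _) (norm_nonneg _)) (by positivity)) (abs_nonneg _)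
        _ = |χ (t, x)| * ‖fderiv ℝ H (t, x) (timeVec E)‖ *
              ‖(fderiv ℝ H (t, x)).comp (ContinuousLinearMap.inr ℝ ℝ E)‖ ^ m := by ring
        _ ≤ M := hM _ hp
    · rw [image_eq_zero_of_notMem_tsupport hp, abs_zero, zero_mul]; exact hM0
  -- bound for each slice pairing, then integrate over `[0, 1]`
  by_cases hmass : T.mass = ⊤
  · rw [hmass]
    rcases eq_or_lt_of_le hM0 with h0 | hpos
    · -- `M = 0`: all slices vanish
      have hz : ∀ t, TestForm.tslice (TestForm.pullback χ hH φ) t = 0 := fun t => by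
        apply TestFunction.ext; intro x
        have := hb t x; rw [← h0, norm_le_zero_iff] at this; exact this
      simp_rw [hz, map_zero, intervalIntegral.integral_zero, ENNReal.ofReal_zero]
      exact bot_le
    · rw [ENNReal.mul_top (ENNReal.ofReal_pos.2 hpos).ne']; exact le_top
  have hT : ∀ t, |T (TestForm.tslice (TestForm.pullback χ hH φ) t)| ≤ M * T.mass.toReal := by
    intro t
    rcases eq_or_lt_of_le hM0 with h0 | hpos
    · have hz : TestForm.tslice (TestForm.pullback χ hH φ) t = 0 := by
        apply TestFunction.ext; intro x
        have := hb t x; rw [← h0, norm_le_zero_iff] at this; exact this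
      rw [hz, map_zero, abs_zero]; positivity
    · exact T.abs_apply_le_mul_toReal_mass hmass hpos (hb t)
  have hint := intervalIntegral.norm_integral_le_of_norm_le_const (a := (0 : ℝ)) (b := 1)
    (f := fun t => T (TestForm.tslice (TestForm.pullback χ hH φ) t)) fun t _ => hT t
  rw [sub_zero, abs_one, mul_one, Real.norm_eq_abs] at hint
  calc ENNReal.ofReal (∫ t in (0 : ℝ)..1, T (TestForm.tslice (TestForm.pullback χ hH φ) t))
      ≤ ENNReal.ofReal (M * T.mass.toReal) := ENNReal.ofReal_le_ofReal ((le_abs_self _).trans hint)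
    _ = ENNReal.ofReal M * T.mass := by
        rw [ENNReal.ofReal_mul hM0, ENNReal.ofReal_toReal hmass]

end HomotopyMass

/-! ### The affine homotopy between two smooth maps -/

section Affine

variable {E E' : Type*} [NormedAddCommGroup E] [NormedSpace ℝ E] [NormedAddCommGroup E']
  [NormedSpace ℝ E'] {Ω : Opens E} {Ω' : Opens E'} {m : ℕ}

/-- **The affine homotopy** `h(t, x) = (1 − t) f(x) + t g(x) = f(x) + t (g(x) − f(x))` from `f` to `g`.
[cite: Federer1969, 4.1.9] -/
def affineHomotopy (f g : E → E') : ℝ × E → E' := fun p => f p.2 + p.1 • (g p.2 - f p.2)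

omit [NormedAddCommGroup E] [NormedSpace ℝ E] in
/-- `h(0, ·) = f`. [folklore] -/
@[simp] theorem affineHomotopy_zero (f g : E → E') (x : E) : affineHomotopy f g (0, x) = f x := by
  simp [affineHomotopy]

omit [NormedAddCommGroup E] [NormedSpace ℝ E] in
/-- `h(1, ·) = g`. [folklore] -/
@[simp] theorem affineHomotopy_one (f g : E → E') (x : E) : affineHomotopy f g (1, x) = g x := by
  simp [affineHomotopy]

/-- The affine homotopy between smooth maps is smooth. [folklore] -/
theorem contDiff_affineHomotopy {f g : E → E'} (hf : ContDiff ℝ ∞ f) (hg : ContDiff ℝ ∞ g) :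
    ContDiff ℝ ∞ (affineHomotopy f g) :=
  (hf.comp contDiff_snd).add (contDiff_fst.smul ((hg.sub hf).comp contDiff_snd))

/-- **The derivative of the affine homotopy**:
`Dh(t,x)(s, v) = Df(x)v + t (Dg(x)v − Df(x)v) + s (g x − f x)`. [folklore] -/
theorem hasFDerivAt_affineHomotopy {f g : E → E'} (hf : ContDiff ℝ ∞ f) (hg : ContDiff ℝ ∞ g)
    (t : ℝ) (x : E) :
    HasFDerivAt (affineHomotopy f g)
      ((fderiv ℝ f x).comp (ContinuousLinearMap.snd ℝ ℝ E) +
        (t • ((fderiv ℝ g x - fderiv ℝ f x).comp (ContinuousLinearMap.snd ℝ ℝ E)) +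
          (ContinuousLinearMap.fst ℝ ℝ E).smulRight (g x - f x))) ((t : ℝ), x) := by
  have hdf : HasFDerivAt f (fderiv ℝ f x) x := (hf.differentiable (by simp) x).hasFDerivAt
  have hdg : HasFDerivAt g (fderiv ℝ g x) x := (hg.differentiable (by simp) x).hasFDerivAt
  have h1 : HasFDerivAt (fun p : ℝ × E => f p.2) ((fderiv ℝ f x).comp (ContinuousLinearMap.snd ℝ ℝ E))
      ((t : ℝ), x) := hdf.comp ((t : ℝ), x) (hasFDerivAt_snd (𝕜 := ℝ) (p := ((t : ℝ), x)))
  have h2 : HasFDerivAt (fun p : ℝ × E => g p.2 - f p.2)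
      ((fderiv ℝ g x - fderiv ℝ f x).comp (ContinuousLinearMap.snd ℝ ℝ E)) ((t : ℝ), x) :=
    ((hdg.comp ((t : ℝ), x) (hasFDerivAt_snd (𝕜 := ℝ) (p := ((t : ℝ), x)))).sub
      (hdf.comp ((t : ℝ), x) (hasFDerivAt_snd (𝕜 := ℝ) (p := ((t : ℝ), x))))).congr_fderiv
      (by rw [ContinuousLinearMap.sub_comp])
  have h3 : HasFDerivAt (fun p : ℝ × E => p.1 • (g p.2 - f p.2))
      ((t : ℝ) • ((fderiv ℝ g x - fderiv ℝ f x).comp (ContinuousLinearMap.snd ℝ ℝ E)) +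
        (ContinuousLinearMap.fst ℝ ℝ E).smulRight (g x - f x)) ((t : ℝ), x) :=
    (hasFDerivAt_fst (𝕜 := ℝ) (p := ((t : ℝ), x))).smul h2
  exact h1.add h3

/-- `Dh(t,x)(e₀) = g(x) − f(x)`. [cite: Federer1969, 4.1.9] -/
theorem fderiv_affineHomotopy_timeVec {f g : E → E'} (hf : ContDiff ℝ ∞ f) (hg : ContDiff ℝ ∞ g)
    (t : ℝ) (x : E) : fderiv ℝ (affineHomotopy f g) ((t : ℝ), x) (timeVec E) = g x - f x := by
  rw [(hasFDerivAt_affineHomotopy hf hg t x).fderiv]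
  simp [timeVec]

/-- `Dh(t,x)|_E = Df(x) + t (Dg(x) − Df(x))`. [cite: Federer1969, 4.1.9] -/
theorem fderiv_affineHomotopy_comp_inr {f g : E → E'} (hf : ContDiff ℝ ∞ f) (hg : ContDiff ℝ ∞ g)
    (t : ℝ) (x : E) :
    (fderiv ℝ (affineHomotopy f g) ((t : ℝ), x)).comp (ContinuousLinearMap.inr ℝ ℝ E) =
      fderiv ℝ f x + t • (fderiv ℝ g x - fderiv ℝ f x) := by
  rw [(hasFDerivAt_affineHomotopy hf hg t x).fderiv]
  ext v
  simp

/-- For `t ∈ [0, 1]`, `‖Df(x) + t (Dg(x) − Df(x))‖ ≤ max ‖Df(x)‖ ‖Dg(x)‖` (convex combination).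
[folklore] -/
theorem norm_add_smul_sub_le {F : Type*} [SeminormedAddCommGroup F] [NormedSpace ℝ F] (A B : F)
    {t : ℝ} (ht : t ∈ Set.Icc (0 : ℝ) 1) : ‖A + t • (B - A)‖ ≤ max ‖A‖ ‖B‖ := by
  have h : A + t • (B - A) = (1 - t) • A + t • B := by
    rw [smul_sub, sub_smul, one_smul]; abel
  rw [h]
  calc ‖(1 - t) • A + t • B‖ ≤ ‖(1 - t) • A‖ + ‖t • B‖ := norm_add_le _ _
    _ = (1 - t) * ‖A‖ + t * ‖B‖ := by
        rw [norm_smul, norm_smul, Real.norm_eq_abs, Real.norm_eq_abs, abs_of_nonneg (by linarith [ht.2]),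
          abs_of_nonneg ht.1]
    _ ≤ (1 - t) * max ‖A‖ ‖B‖ + t * max ‖A‖ ‖B‖ := by
        gcongr
        · linarith [ht.2]
        · exact le_max_left _ _
        · exact ht.1
        · exact le_max_right _ _
    _ = max ‖A‖ ‖B‖ := by ring

/-- **Tensor cutoffs on the cylinder**: `(ρ ⊗ χ)(t, x) = ρ(t) χ(x)` for test functions `ρ` on `ℝ`
and `χ` on `Ω`. [folklore] -/
def TestFunction.tensorCutoff (ρ : 𝓓((⊤ : Opens ℝ), ℝ)) (χ : 𝓓(Ω, ℝ)) : 𝓓(cylinder Ω, ℝ) :=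
  ⟨fun p => ρ p.1 * χ p.2, (ρ.contDiff.comp contDiff_fst).mul (χ.contDiff.comp contDiff_snd),
    (ρ.hasCompactSupport.isCompact.prod χ.hasCompactSupport.isCompact).of_isClosed_subset
      (isClosed_tsupport _) (closure_minimal (fun p hp => by
        refine ⟨subset_tsupport _ ?_, subset_tsupport _ ?_⟩
        · intro h0; exact hp (by simp [h0])
        · intro h0; exact hp (by simp [h0]))
        (ρ.hasCompactSupport.isCompact.prod χ.hasCompactSupport.isCompact).isClosed),
    by
      refine (closure_minimal (fun p hp => ?_) ((isClosed_tsupport ⇑ρ).prod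
        (isClosed_tsupport ⇑χ))).trans ?_
      · refine ⟨subset_tsupport _ ?_, subset_tsupport _ ?_⟩
        · intro h0; exact hp (by simp [h0])
        · intro h0; exact hp (by simp [h0])
      · rintro ⟨t, x⟩ ⟨-, hx⟩
        rw [coe_cylinder]
        exact ⟨mem_univ _, χ.tsupport_subset hx⟩⟩

/-- Formula for the tensor cutoff. [folklore] -/
@[simp] theorem TestFunction.tensorCutoff_apply (ρ : 𝓓((⊤ : Opens ℝ), ℝ)) (χ : 𝓓(Ω, ℝ))
    (p : ℝ × E) : TestFunction.tensorCutoff ρ χ p = ρ p.1 * χ p.2 := rfl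

/-- The support of the tensor cutoff. [folklore] -/
theorem TestFunction.tsupport_tensorCutoff_subset (ρ : 𝓓((⊤ : Opens ℝ), ℝ)) (χ : 𝓓(Ω, ℝ)) :
    tsupport ⇑(TestFunction.tensorCutoff ρ χ) ⊆ tsupport ⇑ρ ×ˢ tsupport ⇑χ := by
  refine closure_minimal (fun p hp => ?_) ((isClosed_tsupport ⇑ρ).prod (isClosed_tsupport ⇑χ))
  refine ⟨subset_tsupport _ ?_, subset_tsupport _ ?_⟩
  · intro h0; exact hp (by simp [h0])
  · intro h0; exact hp (by simp [h0])

/-- Slices of the tensor cutoff: `(ρ ⊗ χ)(t, ·) = ρ(t) χ`. [folklore] -/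
theorem TestFunction.scalarSlice_tensorCutoff (ρ : 𝓓((⊤ : Opens ℝ), ℝ)) (χ : 𝓓(Ω, ℝ)) (t : ℝ) :
    TestFunction.scalarSlice (TestFunction.tensorCutoff ρ χ) t = ρ t • χ := by
  apply TestFunction.ext; intro x; rfl

/-- Push-forwards along pointwise equal maps agree. [folklore] -/
theorem Current.pushforward_congr_fun (T : Current Ω m) (χ : 𝓓(Ω, ℝ)) {f g : E → E'}
    (hf : ContDiff ℝ ∞ f) (hg : ContDiff ℝ ∞ g) (h : ∀ x, f x = g x) :
    T.pushforward Ω' χ hf = T.pushforward Ω' χ hg := by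
  obtain rfl : f = g := funext h
  rfl

end Affine

section AffineFD

variable {E E' : Type*} [NormedAddCommGroup E] [NormedSpace ℝ E] [FiniteDimensional ℝ E]
  [NormedAddCommGroup E'] [NormedSpace ℝ E'] {Ω : Opens E} {Ω' : Opens E'} {m : ℕ}

/-- **The homotopy formula for the affine homotopy** [Federer1969, 4.1.9]:
`g_# T − f_# T = ∂ h_#([0,1] × T) + h_#([0,1] × ∂T)`, with cutoffs: `χ = 1` near `spt T` for
`f_#, g_#`, and `ρ ⊗ χ` on the cylinder with `ρ = 1` near `[0, 1]` for `h_#`.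
[cite: Federer1969, 4.1.9] -/
theorem Current.homotopy_formula_affine (T : Current Ω (m + 1)) (χ : 𝓓(Ω, ℝ))
    (ρ : 𝓓((⊤ : Opens ℝ), ℝ)) {f g : E → E'} (hf : ContDiff ℝ ∞ f) (hg : ContDiff ℝ ∞ g)
    {U : Set E} (hU : IsOpen U) (hTU : T.support ⊆ U) (hχ : ∀ x ∈ U, χ x = 1)
    {V : Set ℝ} (hV : IsOpen V) (h01 : Set.Icc (0 : ℝ) 1 ⊆ V) (hρ : ∀ t ∈ V, ρ t = 1) :
    T.pushforward Ω' χ hg - T.pushforward Ω' χ hf =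
      ((T.prodInterval 0 1).pushforward Ω' (TestFunction.tensorCutoff ρ χ)
          (contDiff_affineHomotopy hf hg)).boundary +
        (T.boundary.prodInterval 0 1).pushforward Ω' (TestFunction.tensorCutoff ρ χ)
          (contDiff_affineHomotopy hf hg) := by
  have hsupp : (T.prodInterval 0 1).support ⊆ V ×ˢ U :=
    (T.support_prodInterval_subset 0 1).trans (Set.prod_mono
      (by rw [Set.uIcc_of_le zero_le_one]; exact h01) hTU)
  have h1 : ∀ p ∈ V ×ˢ U, TestFunction.tensorCutoff ρ χ p = 1 := fun p hp => by
    rw [TestFunction.tensorCutoff_apply, hρ _ hp.1, hχ _ hp.2, one_mul]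
  rw [T.homotopy_formula (TestFunction.tensorCutoff ρ χ) (contDiff_affineHomotopy hf hg)
    (hV.prod hU) hsupp h1, TestFunction.scalarSlice_tensorCutoff,
    TestFunction.scalarSlice_tensorCutoff, hρ 1 (h01 ⟨zero_le_one, le_rfl⟩),
    hρ 0 (h01 ⟨le_rfl, zero_le_one⟩), one_smul,
    T.pushforward_congr_fun χ ((contDiff_affineHomotopy hf hg).comp (contDiff_sliceMap 1)) hg
      (fun x => affineHomotopy_one f g x),
    T.pushforward_congr_fun χ ((contDiff_affineHomotopy hf hg).comp (contDiff_sliceMap 0)) hf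
      (fun x => affineHomotopy_zero f g x)]
  abel

end AffineFD

section AffineMass

variable {E E' : Type*} [NormedAddCommGroup E] [NormedSpace ℝ E] [NormedAddCommGroup E']
  [NormedSpace ℝ E'] {Ω : Opens E} {Ω' : Opens E'} {m : ℕ}

/-- **Mass of the affine homotopy current** [Federer1969, 4.1.9]: if `|ρ| ≤ 1`, `spt ρ ⊆ [0, 1]⁺`
where the convexity bound is required only on `spt ρ`, and
`|χ(x)| ‖g x − f x‖ ‖Df(x) + t(Dg(x) − Df(x))‖ᵐ ≤ M` for `(t, x) ∈ spt ρ × spt χ`, then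
`𝐌(h_#([0,1] × T)) ≤ M 𝐌(T)`. (For `t ∈ [0,1]` the middle factor is `≤ max(‖Df‖, ‖Dg‖)ᵐ`,
`norm_add_smul_sub_le`.) [cite: Federer1969, 4.1.9] -/
theorem Current.mass_affineHomotopy_le (T : Current Ω m) (χ : 𝓓(Ω, ℝ)) (ρ : 𝓓((⊤ : Opens ℝ), ℝ))
    {f g : E → E'} (hf : ContDiff ℝ ∞ f) (hg : ContDiff ℝ ∞ g) {M : ℝ} (hM0 : 0 ≤ M)
    (hρ1 : ∀ t, |ρ t| ≤ 1)
    (hM : ∀ t ∈ tsupport ⇑ρ, ∀ x ∈ tsupport ⇑χ,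
      |χ x| * ‖g x - f x‖ * ‖fderiv ℝ f x + t • (fderiv ℝ g x - fderiv ℝ f x)‖ ^ m ≤ M) :
    ((T.prodInterval 0 1).pushforward Ω' (TestFunction.tensorCutoff ρ χ)
        (contDiff_affineHomotopy hf hg)).mass ≤ ENNReal.ofReal M * T.mass := by
  refine T.mass_pushforward_prodInterval_le _ _ hM0 fun p hp => ?_
  obtain ⟨ht, hx⟩ := TestFunction.tsupport_tensorCutoff_subset ρ χ hp
  rw [TestFunction.tensorCutoff_apply, show p = ((p.1 : ℝ), p.2) from rfl,
    fderiv_affineHomotopy_timeVec hf hg, fderiv_affineHomotopy_comp_inr hf hg, abs_mul]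
  calc |ρ p.1| * |χ p.2| * ‖g p.2 - f p.2‖ *
        ‖fderiv ℝ f p.2 + p.1 • (fderiv ℝ g p.2 - fderiv ℝ f p.2)‖ ^ m
      ≤ 1 * |χ p.2| * ‖g p.2 - f p.2‖ *
        ‖fderiv ℝ f p.2 + p.1 • (fderiv ℝ g p.2 - fderiv ℝ f p.2)‖ ^ m := by
        gcongr
        exact hρ1 _
    _ = |χ p.2| * ‖g p.2 - f p.2‖ *
        ‖fderiv ℝ f p.2 + p.1 • (fderiv ℝ g p.2 - fderiv ℝ f p.2)‖ ^ m := by rw [one_mul]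
    _ ≤ M := hM _ ht _ hx

end AffineMass

/-! ### The cone construction: every current is a boundary plus a cone over its boundary -/

section Cone

variable {E E' : Type*} [NormedAddCommGroup E] [NormedSpace ℝ E] [NormedAddCommGroup E']
  [NormedSpace ℝ E'] {Ω : Opens E} {Ω' : Opens E'} {m : ℕ}

/-- **Push-forwards of positive-degree currents along constant maps vanish** (`f^# φ = 0` as
`Df = 0`). [folklore] -/
theorem Current.pushforward_const (T : Current Ω (m + 1)) (χ : 𝓓(Ω, ℝ)) (c : E') :
    T.pushforward Ω' χ (contDiff_const (c := c)) = 0 := by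
  ext φ
  rw [Current.pushforward_apply]
  change T _ = (0 : ℝ)
  convert map_zero T
  apply TestFunction.ext
  intro x
  rw [TestForm.pullback_apply, fderiv_fun_const]
  change χ x • (φ c).compContinuousLinearMap 0 = 0
  have h0 : (φ c).compContinuousLinearMap (0 : E →L[ℝ] E') = 0 := by
    ext v
    rw [ContinuousAlternatingMap.compContinuousLinearMap_apply]
    exact (φ c).map_coord_zero 0 rfl
  rw [h0, smul_zero]

end Cone

section ConeFD

variable {E : Type*} [NormedAddCommGroup E] [NormedSpace ℝ E] [FiniteDimensional ℝ E]
  {Ω : Opens E} {m : ℕ}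

/-- **The push-forward along the identity is the identity** (for a cutoff `= 1` near `spt T`).
[folklore] -/
theorem Current.pushforward_id (T : Current Ω m) (χ : 𝓓(Ω, ℝ)) {U : Set E} (hU : IsOpen U)
    (hTU : T.support ⊆ U) (hχ : ∀ x ∈ U, χ x = 1) :
    T.pushforward Ω χ (contDiff_id (𝕜 := ℝ) (E := E)) = T := by
  ext φ
  rw [Current.pushforward_apply, ← sub_eq_zero, ← map_sub]
  refine T.apply_eq_zero_of_eqOn hU hTU fun x hx => ?_
  show TestForm.pullback χ contDiff_id φ x - φ x = 0
  rw [TestForm.pullback_apply, hχ x hx, one_smul, fderiv_id]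
  change (φ x).compContinuousLinearMap (ContinuousLinearMap.id ℝ E) - φ x = 0
  have hid : (φ x).compContinuousLinearMap (ContinuousLinearMap.id ℝ E) = φ x := by
    ext v; rfl
  rw [hid, sub_self]

/-- **The cone formula** [Federer1969, 4.1.11, via 4.1.9 with `f ≡ c`, `g = id`]: with
`h(t, x) = c + t (x − c)` the affine homotopy from the constant map `c` to the identity
(`f_# T = 0` in positive degree, `id_# T = T`),
`T = ∂ h_#([0,1] × T) + h_#([0,1] × ∂T)` for every `T ∈ 𝒟_{m+1}(Ω)`; in particular **a cycle is the
boundary of its cone**. Cutoffs as in `Current.homotopy_formula_affine`. [cite: Federer1969, 4.1.11] -/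
theorem Current.cone_formula (T : Current Ω (m + 1)) (χ : 𝓓(Ω, ℝ)) (ρ : 𝓓((⊤ : Opens ℝ), ℝ))
    (c : E) {U : Set E} (hU : IsOpen U) (hTU : T.support ⊆ U) (hχ : ∀ x ∈ U, χ x = 1)
    {V : Set ℝ} (hV : IsOpen V) (h01 : Set.Icc (0 : ℝ) 1 ⊆ V) (hρ : ∀ t ∈ V, ρ t = 1) :
    T = ((T.prodInterval 0 1).pushforward Ω (TestFunction.tensorCutoff ρ χ)
          (contDiff_affineHomotopy (contDiff_const (c := c)) contDiff_id)).boundary +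
        (T.boundary.prodInterval 0 1).pushforward Ω (TestFunction.tensorCutoff ρ χ)
          (contDiff_affineHomotopy (contDiff_const (c := c)) contDiff_id) := by
  have h := T.homotopy_formula_affine (Ω' := Ω) χ ρ (contDiff_const (c := c))
    (contDiff_id (𝕜 := ℝ) (E := E)) hU hTU hχ hV h01 hρ
  rwa [T.pushforward_id χ hU hTU hχ, T.pushforward_const χ c, sub_zero] at h

end ConeFD

section ConeMass

variable {E : Type*} [NormedAddCommGroup E] [NormedSpace ℝ E] {Ω Ω' : Opens E} {m : ℕ}

/-- **Mass of the cone** [Federer1969, 4.1.11: "`𝐌(0 ⨉ T) ≤ r 𝐌(T)` if `spt T ⊆ 𝐁(0, r)`"-type]: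
with cutoffs `|χ|, |ρ| ≤ 1`, `spt χ ⊆ 𝐁(c, r)` and `spt ρ ⊆ [−1 − δ, 1 + δ]`,
`𝐌(h_#([0,1] × T)) ≤ r (1 + δ)ᵐ 𝐌(T)` for the cone homotopy `h(t,x) = c + t(x − c)`.
[cite: Federer1969, 4.1.11] -/
theorem Current.mass_cone_le (T : Current Ω m) (χ : 𝓓(Ω, ℝ)) (ρ : 𝓓((⊤ : Opens ℝ), ℝ)) (c : E)
    {r δ : ℝ} (hr : 0 ≤ r) (hδ : 0 ≤ δ) (hχ1 : ∀ x, |χ x| ≤ 1) (hρ1 : ∀ t, |ρ t| ≤ 1)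
    (hχr : ∀ x ∈ tsupport ⇑χ, ‖x - c‖ ≤ r) (hρδ : ∀ t ∈ tsupport ⇑ρ, |t| ≤ 1 + δ) :
    ((T.prodInterval 0 1).pushforward Ω' (TestFunction.tensorCutoff ρ χ)
        (contDiff_affineHomotopy (contDiff_const (c := c)) contDiff_id)).mass ≤
      ENNReal.ofReal (r * (1 + δ) ^ m) * T.mass := by
  refine T.mass_affineHomotopy_le χ ρ (contDiff_const (c := c)) contDiff_id (by positivity) hρ1
    fun t ht x hx => ?_
  rw [fderiv_fun_const, fderiv_id, Pi.zero_apply, zero_add, sub_zero, norm_smul, Real.norm_eq_abs]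
  have hid : ‖ContinuousLinearMap.id ℝ E‖ ≤ 1 := ContinuousLinearMap.norm_id_le
  have hx' : ‖id x - c‖ ≤ r := hχr x hx
  have h1 : |χ x| * ‖id x - c‖ ≤ 1 * r :=
    mul_le_mul (hχ1 x) hx' (norm_nonneg _) zero_le_one
  have h2 : |t| * ‖ContinuousLinearMap.id ℝ E‖ ≤ (1 + δ) * 1 :=
    mul_le_mul (hρδ t ht) hid (norm_nonneg _) (by linarith)
  calc |χ x| * ‖id x - c‖ * (|t| * ‖ContinuousLinearMap.id ℝ E‖) ^ m
      ≤ 1 * r * ((1 + δ) * 1) ^ m :=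
        mul_le_mul h1 (pow_le_pow_left₀ (mul_nonneg (abs_nonneg _) (norm_nonneg _)) h2 m)
          (pow_nonneg (mul_nonneg (abs_nonneg _) (norm_nonneg _)) m) (by positivity)
    _ = r * (1 + δ) ^ m := by ring

end ConeMass

end Literature.Geometry.GeometricMeasureTheory
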